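import Summits.ABC.ABC.Theorems.YuMatveevShapeRatCloses
import Literature.Barriers.ABC.BakerMethodBoundsProofs
import Literature.Barriers.ABC.BakerMethodBoundsSubexpProofs
import HarnessLib

/-!
# A1.L's payoff toward A1.H: Pasten's 2024 subexponential abc bounds (Thm 1.4 (1)/(2)) CONDITIONAL ON ONE NAMED FACT —
# the Shimura-curve input `pasten2024_thm_2_5` — now that the linear-forms input is the kernel theorem `approximationBound_rat_holds`

`Summits/ABC/ABC/Theorems/Pasten2024HybridOfShimura.lean` — cell `abc-stewartyu` (plan g12 R51 (4), A1L-CLOSE.md N1; seat p2 g8), filed after the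
rung F-A1.L closed (`Summit.ABC.ABC.Theorems.approximationBound_rat_holds`, ✓ p584875, route `YuMatveevShapeRat` CLOSED·proved
2026-08-27T23:30Z).  PROOFS ONLY.  Pasten, *Invent. Math.* 236 (2024), Theorem 1.4 rests on TWO inputs: Theorem 2.1 (linear forms in
logarithms over `ℚ`, `d = 1`) and Theorem 2.5 (the Shimura-curve bound `∏ ν_p(abc) ≪_ε rad^{8/3+ε}`).  The tree held the deduction with
BOTH inputs as named facts (`Literature.Barriers.ABC.pasten2024_thm_1_4_1_of_facts`, `…_of`: binders `evertseGyory_thm_4_2_1_rat` and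
`pasten2024_thm_2_5`); the first binder is now discharged by the rung, so Theorem 1.4 (1) and (2) become conditional on the ONE remaining
named fact `Literature.NumberTheory.DiophantineGeometry.pasten2024_thm_2_5` (rung A1.H's only open hypothesis):

* `pasten2024_thm_1_4_1_of_thm_2_5 : pasten2024_thm_2_5 → pasten2024_thm_1_4_1` (small member: `log c ≤ η⁻¹·exp(κ√(log R·log₂R))` for
  `a ≤ c^{1−η}`) via ✓ `pasten2024_thm_1_4_1_of_approximationBound`;
* `pasten2024_thm_1_4_2_of_thm_2_5 : pasten2024_thm_2_5 → pasten2024_thm_1_4_2` (`log c ≤ q·exp(κ√(log R·log₂R))`, `q = min P(·)`) via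
  ✓ `pasten2024_thm_1_4_2_of_bounds`.

WHAT THIS IS NOT: a proof of Theorem 1.4 (the Shimura-curve fact is NOT in the tree: these are CONDITIONAL results, `proof.conditional`);
an abc claim; rung A1.H is NOT moved by this file.
-/

-- `Summit.<Summit>.<Problem>` is the mandated summit-side namespace (CONVENTIONS §2); for the single-conjunct summit `ABC` the two
-- coincide, so the duplicate `ABC.ABC` is deliberate.
set_option linter.dupNamespace false

namespace Summit.ABC.ABC.Theorems

open Literature.NumberTheory.DiophantineGeometry
open Literature.Barriers.ABC

/-- **Pasten 2024, Theorem 1.4 (1), conditional on Theorem 2.5 only** (the linear-forms input is the kernel theorem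
`approximationBound_rat_holds`). [cite: Pasten2024, Theorem 1.4 (1)] [cite: Pasten2024, Theorem 2.5] -/
theorem pasten2024_thm_1_4_1_of_thm_2_5 (h25 : pasten2024_thm_2_5) : pasten2024_thm_1_4_1 := by
  obtain ⟨K, hK, hP⟩ := approximationBound_rat_holds
  exact pasten2024_thm_1_4_1_of_approximationBound hP hK h25

/-- **Pasten 2024, Theorem 1.4 (2), conditional on Theorem 2.5 only** (the linear-forms input is the kernel theorem
`approximationBound_rat_holds`). [cite: Pasten2024, Theorem 1.4 (2)] [cite: Pasten2024, Theorem 2.5] -/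
theorem pasten2024_thm_1_4_2_of_thm_2_5 (h25 : pasten2024_thm_2_5) : pasten2024_thm_1_4_2 := by
  obtain ⟨K, hK, hP⟩ := approximationBound_rat_holds
  exact pasten2024_thm_1_4_2_of_bounds hK hP h25

end Summit.ABC.ABC.Theorems
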